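import Summits.ResolutionOfSingularities.ResolutionOfSingularities.Theorems.FrobeniusLadderFRationalResolutionConeChartEntry
import HarnessLib

/-!
# Crux `FrobeniusLadder.FRationalResolution` (stmt-ResolutionOfSingularities-15317), line `redirect`,
# stub `stub_diagonalizableQuotientResolution` — **the rank at a singular surface point is two**
# (companion of `…ConeChartEntry`: the chart of `…IsolatedQuotientResolution.exists_sharp_affine_chart` has
# some rank `n`; at a SINGULAR point of a surface `n = 2`, so `…ConeChartEntry.exists_normalForm_of_not_
# isRegularLocalRing` applies after `subst`)

For a chart `φ : P → A`, `P ⊆ ℤⁿ` finitely generated, saturated, spanning, log regular at `𝔭` with unit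
face `0`:

* `natCast_rank_le_ringKrullDim` — `n ≤ dim A_𝔭` (Kato's dimension formula with rank term `n`);
* `isRegularLocalRing_of_rank_zero`, `isRegularLocalRing_of_rank_one` — for `n ≤ 1` the monoid is free
  (`{0}`, resp. `ℕ·(±1)` by sharpness and saturation), so `A_𝔭` is regular (Kato (10.3), orthant-like
  base chart);
* **`rank_eq_two_of_not_isRegularLocalRing`** — `dim A_𝔭 ≤ 2` and `A_𝔭` not regular force `n = 2`.

Honest label: bookkeeping toward ONE leaf stub (no stub, crux or summit closed). No definitions, no named
facts, no sorry. [cite: Kato1994, Def. (2.1), (10.3)]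
-/

noncomputable section

-- single-problem summit: the doubled namespace component is forced
set_option linter.dupNamespace false

open IsLocalRing Literature.AlgebraicGeometry.Resolution Literature.AlgebraicGeometry.Resolution.LogChart
  Literature.AlgebraicGeometry.Resolution.LogRefinedChart
open Summit.ResolutionOfSingularities.ResolutionOfSingularities.Theorems.FRationalResolution.ChartAlgebraOrthantPoints
open Summit.ResolutionOfSingularities.ResolutionOfSingularities.Theorems.FRationalResolution.BaseChartAlgebra
open Summit.ResolutionOfSingularities.ResolutionOfSingularities.Theorems.FRationalResolution.ConeChartEntry

namespace Summit.ResolutionOfSingularities.ResolutionOfSingularities.Theorems.FRationalResolution.ConeChartRank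

universe u

variable {A : Type u} [CommRing A]

/-- **`n ≤ dim A_𝔭`** for a chart with unit face `0`, log regular at `𝔭`. [cite: Kato1994, Def. (2.1)] -/
theorem natCast_rank_le_ringKrullDim {n : ℕ} {P : AddSubmonoid (Fin n → ℤ)} {φ : Multiplicative P →* A}
    {𝔭 : Ideal A} [𝔭.IsPrime] (hreg : IsLogRegularAt P φ 𝔭)
    (hface : ∀ p : P, (p : Fin n → ℤ) ≠ 0 → φ (Multiplicative.ofAdd p) ∈ 𝔭) :
    ((n : ℕ) : WithBot ℕ∞) ≤ ringKrullDim (Localization.AtPrime 𝔭) := by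
  have hr := finrank_span_face_eq_zero (P := P) (φ := φ) (𝔭 := 𝔭) hface
  have h2 := hreg.2
  rw [hr, Nat.sub_zero] at h2
  haveI := hreg.1
  have hq0 : (0 : WithBot ℕ∞) ≤ ringKrullDim (Localization.AtPrime 𝔭 ⧸
      (ideal P φ 𝔭).map (algebraMap A (Localization.AtPrime 𝔭))) := ringKrullDim_nonneg_of_nontrivial
  rw [h2]
  exact le_add_of_nonneg_left hq0

/-- `dim A_𝔭 ≤ N` forces `n ≤ N`. [cite: Kato1994, Def. (2.1)] -/
theorem rank_le_of_ringKrullDim_le {n : ℕ} {P : AddSubmonoid (Fin n → ℤ)} {φ : Multiplicative P →* A}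
    {𝔭 : Ideal A} [𝔭.IsPrime] (hreg : IsLogRegularAt P φ 𝔭)
    (hface : ∀ p : P, (p : Fin n → ℤ) ≠ 0 → φ (Multiplicative.ofAdd p) ∈ 𝔭) {N : ℕ}
    (hdim : ringKrullDim (Localization.AtPrime 𝔭) ≤ (N : ℕ)) : n ≤ N := by
  have h := (natCast_rank_le_ringKrullDim hreg hface).trans hdim
  have h' : ((n : ℕ∞) : WithBot ℕ∞) ≤ ((N : ℕ∞) : WithBot ℕ∞) := h
  rw [WithBot.coe_le_coe] at h'
  exact_mod_cast h'

variable [IsNoetherianRing A]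

omit [IsNoetherianRing A] in
/-- The identity chart is log regular at `𝔭.comap id`. [folklore] -/
theorem isLogRegularAt_comap_self {n : ℕ} {P : AddSubmonoid (Fin n → ℤ)} {φ : Multiplicative P →* A}
    {𝔭 : Ideal A} [𝔭.IsPrime] (hreg : IsLogRegularAt P φ 𝔭) :
    IsLogRegularAt P φ ((𝔭 : Ideal A).comap (algebraMap A A)) := by
  have key : ∀ (𝔮 : Ideal A) [𝔮.IsPrime], 𝔮 = 𝔭 → IsLogRegularAt P φ 𝔮 := by
    intro 𝔮 _ h; subst h; exact hreg
  exact key _ (by ext x; simp)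

/-- **Rank `0`: regular.** (`P = {0} = ℤ⁰`, the base chart is orthant-like.) [cite: Kato1994, (10.3)] -/
theorem isRegularLocalRing_of_rank_zero {P : AddSubmonoid (Fin 0 → ℤ)} {φ : Multiplicative P →* A}
    {𝔭 : Ideal A} [𝔭.IsPrime] (hP : P.FG)
    (hsat : ∀ (w : Fin 0 → ℤ) (k : ℕ), 0 < k → k • w ∈ P → w ∈ P)
    (hspanP : Submodule.span ℤ (P : Set (Fin 0 → ℤ)) = ⊤) (hreg : IsLogRegularAt P φ 𝔭) :
    IsRegularLocalRing (Localization.AtPrime 𝔭) := by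
  have hI : IsOrthantLike (Pi.basisFun ℤ (Fin 0)) ∅ P := ⟨fun x => by
    constructor
    · intro _ i hi; simp at hi
    · intro _; rw [Subsingleton.elim x 0]; exact P.zero_mem⟩
  exact isRegularLocalRing_localization_of_isOrthantLike hP hsat hspanP hI (le_refl P) self_chi
    self_adjoin_eq_top self_fieldExtension 𝔭 (isLogRegularAt_comap_self hreg)

/-- **Rank `1`: regular.** A sharp saturated spanning `P ⊆ ℤ¹` is `ℕ·(±1)`, orthant-like, so the base
chart gives a regular `A_𝔭`. [cite: Kato1994, (10.3)] -/
theorem isRegularLocalRing_of_rank_one {P : AddSubmonoid (Fin 1 → ℤ)} {φ : Multiplicative P →* A}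
    {𝔭 : Ideal A} [𝔭.IsPrime] (hP : P.FG)
    (hsat : ∀ (w : Fin 1 → ℤ) (k : ℕ), 0 < k → k • w ∈ P → w ∈ P)
    (hspanP : Submodule.span ℤ (P : Set (Fin 1 → ℤ)) = ⊤) (hreg : IsLogRegularAt P φ 𝔭)
    (hface : ∀ p : P, (p : Fin 1 → ℤ) ≠ 0 → φ (Multiplicative.ofAdd p) ∈ 𝔭) :
    IsRegularLocalRing (Localization.AtPrime 𝔭) := by
  have hsharp := sharp_of_face_zero (P := P) (φ := φ) (𝔭 := 𝔭) hface
  -- a generator direction: some `p ∈ P` with `p 0 ≠ 0`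
  obtain ⟨p, hpP, hp0⟩ : ∃ p ∈ P, p 0 ≠ 0 := by
    by_contra hne
    push Not at hne
    have hbot : Submodule.span ℤ (P : Set (Fin 1 → ℤ)) ≤ ⊥ := by
      rw [Submodule.span_le]
      intro q hq
      have : q = 0 := by funext i; fin_cases i; exact hne q hq
      rw [this]; exact Submodule.zero_mem _
    have htop : (fun _ => (1 : ℤ) : Fin 1 → ℤ) ∈ Submodule.span ℤ (P : Set (Fin 1 → ℤ)) := by
      rw [hspanP]; exact Submodule.mem_top
    have := hbot htop
    rw [Submodule.mem_bot] at this
    simpa using congr_fun this 0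
  -- the unit vector `u = σ·1` in the direction of `p` lies in `P`
  obtain ⟨σ, hσ, hσp⟩ : ∃ σ : ℤ, (σ = 1 ∨ σ = -1) ∧ 0 < σ * p 0 := by
    rcases lt_or_gt_of_ne hp0 with h | h
    · exact ⟨-1, Or.inr rfl, by linarith⟩
    · exact ⟨1, Or.inl rfl, by linarith⟩
  have hσσ : σ * σ = 1 := by rcases hσ with rfl | rfl <;> norm_num
  have huP : (fun _ => σ : Fin 1 → ℤ) ∈ P := by
    refine hsat _ (σ * p 0).toNat (by omega) ?_
    have e1 : (σ * p 0).toNat • (fun _ => σ : Fin 1 → ℤ) = p := by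
      rw [← natCast_zsmul, Int.toNat_of_nonneg hσp.le]
      funext i; fin_cases i
      simp only [Pi.smul_apply, smul_eq_mul, Fin.zero_eta]
      linear_combination (p 0) * hσσ
    rw [e1]; exact hpP
  -- membership: `x ∈ P ↔ 0 ≤ σ x₀`
  have hmem : ∀ x : Fin 1 → ℤ, x ∈ P ↔ 0 ≤ σ * x 0 := by
    intro x
    constructor
    · intro hx
      by_contra hneg
      push Not at hneg
      have hnegu : (fun _ => -σ : Fin 1 → ℤ) ∈ P := by
        refine hsat _ (-(σ * x 0)).toNat (by omega) ?_
        have e1 : (-(σ * x 0)).toNat • (fun _ => -σ : Fin 1 → ℤ) = x := by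
          rw [← natCast_zsmul, Int.toNat_of_nonneg (by omega : 0 ≤ -(σ * x 0))]
          funext i; fin_cases i
          simp only [Pi.smul_apply, smul_eq_mul, Fin.zero_eta]
          linear_combination (x 0) * hσσ
        rw [e1]; exact hx
      have h0 := hsharp _ huP (by
        have : -(fun _ => σ : Fin 1 → ℤ) = (fun _ => -σ : Fin 1 → ℤ) := by funext i; simp
        rw [this]; exact hnegu)
      have : σ = 0 := by simpa using congr_fun h0 0
      rcases hσ with h | h <;> omega
    · intro hx
      have e1 : x = (σ * x 0).toNat • (fun _ => σ : Fin 1 → ℤ) := by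
        rw [← natCast_zsmul, Int.toNat_of_nonneg hx]
        funext i; fin_cases i
        simp only [Pi.smul_apply, smul_eq_mul, Fin.zero_eta]
        linear_combination -(x 0) * hσσ
      rw [e1]; exact P.nsmul_mem huP _
  -- orthant-like in the basis `σ·e₀`
  obtain ⟨b, hb⟩ : ∃ b : Module.Basis (Fin 1) ℤ (Fin 1 → ℤ), ∀ x : Fin 1 → ℤ, b.repr x 0 = σ * x 0 := by
    rcases hσ with rfl | rfl
    · exact ⟨Pi.basisFun ℤ (Fin 1), fun x => by simp⟩
    · exact ⟨(Pi.basisFun ℤ (Fin 1)).map (LinearEquiv.neg ℤ), fun x => by simp [Module.Basis.map_repr]⟩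
  have hI : IsOrthantLike b {0} P := ⟨fun x => by
    rw [hmem x]
    constructor
    · intro h i hi
      rw [Finset.mem_singleton] at hi; subst hi; rw [hb]; exact h
    · intro h; rw [← hb]; exact h 0 (Finset.mem_singleton_self 0)⟩
  exact isRegularLocalRing_localization_of_isOrthantLike hP hsat hspanP hI (le_refl P) self_chi
    self_adjoin_eq_top self_fieldExtension 𝔭 (isLogRegularAt_comap_self hreg)

/-- **At a singular point of a surface the rank of a sharp chart is `2`.** For a chart `φ : P → A`,
`P ⊆ ℤⁿ` finitely generated, saturated, spanning, log regular at `𝔭` with unit face `0`: if `dim A_𝔭 ≤ 2`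
and `A_𝔭` is not regular then `n = 2`. [cite: Kato1994, Def. (2.1), (10.3)] -/
theorem rank_eq_two_of_not_isRegularLocalRing {n : ℕ} {P : AddSubmonoid (Fin n → ℤ)}
    {φ : Multiplicative P →* A} {𝔭 : Ideal A} [𝔭.IsPrime] (hP : P.FG)
    (hsat : ∀ (w : Fin n → ℤ) (k : ℕ), 0 < k → k • w ∈ P → w ∈ P)
    (hspanP : Submodule.span ℤ (P : Set (Fin n → ℤ)) = ⊤) (hreg : IsLogRegularAt P φ 𝔭)
    (hface : ∀ p : P, (p : Fin n → ℤ) ≠ 0 → φ (Multiplicative.ofAdd p) ∈ 𝔭)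
    (hdim : ringKrullDim (Localization.AtPrime 𝔭) ≤ (2 : ℕ))
    (hsing : ¬ IsRegularLocalRing (Localization.AtPrime 𝔭)) : n = 2 := by
  have hle : n ≤ 2 := rank_le_of_ringKrullDim_le hreg hface hdim
  rcases Nat.lt_or_ge n 2 with hlt | hge
  · exfalso
    interval_cases n
    · exact hsing (isRegularLocalRing_of_rank_zero hP hsat hspanP hreg)
    · exact hsing (isRegularLocalRing_of_rank_one hP hsat hspanP hreg hface)
  · omega

end Summit.ResolutionOfSingularities.ResolutionOfSingularities.Theorems.FRationalResolution.ConeChartRank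

end
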